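import Summits.AnomalousDissipation.AnomalousDissipation.Theorems.SolenoidalFractalHomogenisationLagrangianStepLossCurrency
import Summits.AnomalousDissipation.AnomalousDissipation.Theorems.SolenoidalFractalHomogenisationLagrangianStepCellClauseModDefs
import Literature.Analysis.FluidPDE.PassiveVectorTensorPropagatorBandKill
import Literature.Analysis.FunctionSpaces.TorusFluidGlueProofs
import HarnessLib

/-!
# K1L_D (stmt-AnomalousDissipation-27980), `stub_Z7_alphaBeta` (N1)/(N1*): the N-CURRENCY ASSEMBLY from a band-loss bound
# (helper, `--supports 27980 --as helper`; prover ad-k1loc-p3 g9, TAKES-p3-g9 D27-3 #3, memo `N1-MEMO-k1locp3g9.md` §1 (A))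

(N1) asks `lossFwd (Um jR s′) x ≤ CN·(Σ_{k∈Sf} min 1 (w k)·‖x̂ k‖² + (‖x‖² − Σ_{k∈Sf} ‖x̂ k‖²))` (`w k = rate_k·τ`).  This file is the
pure Hilbert/Parseval layer (lead's L9 Z7β «split at rate·τ = 1»), for ANY contraction `U` of `V2 = L²(𝕋³; ℝ³)`:
* §1 `loss_add_add_le` — `q(a+b+c) ≤ 4q(a) + 4q(b) + 2q(c)` (`LossCurrency.loss_add_le` twice), `loss_le_norm_sq`;
* §2 Fourier BAND PIECES of an `L²` class `x`: `bandPiece` is NOT a definition of this file — the piece over a symmetric frequency set `S` is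
  written `(memLp_realTrigPoly S 𝓕x 2).toLp (realTrigPoly S 𝓕x)` throughout; facts: `‖piece‖² = Σ_S ‖x̂‖²`, `‖x − piece‖² = ‖x‖² − Σ_S ‖x̂‖²`,
  additivity over a disjoint union, weak solenoidality of the pieces of a weakly solenoidal class;
* §3 **`lossFwd_le_of_bandLoss`** — if the piece of `x` over the SLOW modes `S₁ = {k ∈ Sf | w k < 1}` loses at most `Cg·Σ_{S₁} w k‖x̂ k‖²`
  (the (P)-shaped input: Dirichlet-form bound along the coarse drift — ad-lit g29's Galerkin package), then
  `lossFwd U x ≤ max 4 (4·Cg) · (Σ_{k∈Sf} min 1 (w k)‖x̂ k‖² + (‖x‖² − Σ_{k∈Sf}‖x̂ k‖²))` — the (N1) shape with `CN = max 4 (4·Cg)`;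
  and the adjoint twin `lossAdj_le_of_bandLoss` (apply the first to `U†`, a contraction by `LossCurrency.norm_adjoint_le`).
NOT (N1) itself (the band-loss input (P) is the PDE content), not the stub, not K1L_D, not AD; rung F-D1.A0.
-/

set_option linter.dupNamespace false

noncomputable section

namespace Summit.AnomalousDissipation.AnomalousDissipation.Theorems.SolenoidalFractalHomogenisation.LagrangianStep.N1Assembly

open Literature.Analysis Literature.Analysis.FluidPDE Literature.Analysis.FunctionSpaces
open MeasureTheory Finset UnitAddTorus
open scoped InnerProductSpace ENNReal
open Summit.AnomalousDissipation.AnomalousDissipation.Theorems.SolenoidalFractalHomogenisation.LagrangianStep.LossCurrency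
open Summit.AnomalousDissipation.AnomalousDissipation.Theorems.SolenoidalFractalHomogenisation.LagrangianStep.CellClauseMod

/-! ## §1 Hilbert layer -/

section Hilbert

variable {H : Type*} [NormedAddCommGroup H] [InnerProductSpace ℝ H]

/-- `q(x) ≤ ‖x‖²`. -/
theorem loss_le_norm_sq (T : H →L[ℝ] H) (x : H) : ‖x‖ ^ 2 - ‖T x‖ ^ 2 ≤ ‖x‖ ^ 2 := by
  nlinarith [sq_nonneg ‖T x‖]

/-- Three-piece splitting of the loss of a contraction: `q(a + b + c) ≤ 4 q(a) + 4 q(b) + 2 q(c)`. -/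
theorem loss_add_add_le {T : H →L[ℝ] H} (hT : ∀ y, ‖T y‖ ≤ ‖y‖) (a b c : H) :
    ‖a + b + c‖ ^ 2 - ‖T (a + b + c)‖ ^ 2
      ≤ 4 * (‖a‖ ^ 2 - ‖T a‖ ^ 2) + 4 * (‖b‖ ^ 2 - ‖T b‖ ^ 2) + 2 * (‖c‖ ^ 2 - ‖T c‖ ^ 2) := by
  have h1 := loss_add_le hT (a + b) c
  have h2 := loss_add_le hT a b
  linarith

end Hilbert

/-! ## §2 Fourier band pieces of an `L²` class on `𝕋³` -/

section Pieces

/-- The Fourier coefficients of (the representative of) an `L²` class are conjugate symmetric. -/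
theorem isConjSymm_coeff (x : V2) :
    Torus.IsConjSymm (fun k => mFourierCoeff (EuclideanSpace.complexify ∘ (⇑x : VF)) k) :=
  Torus.isConjSymm_mFourierCoeff ((Lp.memLp x).integrable one_le_two)

/-- **Energy of a band piece**: `‖piece_S x‖² = Σ_{k∈S} ‖x̂ k‖²` (finite Parseval). -/
theorem norm_piece_sq (x : V2) {S : Finset (Fin 3 → ℤ)} (hS : ∀ k ∈ S, -k ∈ S) :
    ‖(Torus.memLp_realTrigPoly S (fun k => mFourierCoeff (EuclideanSpace.complexify ∘ (⇑x : VF)) k) 2).toLp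
        (Torus.realTrigPoly S (fun k => mFourierCoeff (EuclideanSpace.complexify ∘ (⇑x : VF)) k))‖ ^ 2
      = ∑ k ∈ S, ‖mFourierCoeff (EuclideanSpace.complexify ∘ (⇑x : VF)) k‖ ^ 2 := by
  rw [Torus.norm_toLp_sq_eq_integral, Torus.integral_norm_sq_realTrigPoly hS (isConjSymm_coeff x)]

/-- **The pairing of a class with its own band piece** is the partial Parseval sum: `⟪x, piece_S x⟫ = Σ_{k∈S} ‖x̂ k‖²`. -/
theorem inner_piece (x : V2) {S : Finset (Fin 3 → ℤ)} (hS : ∀ k ∈ S, -k ∈ S) :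
    ⟪x, (Torus.memLp_realTrigPoly S (fun k => mFourierCoeff (EuclideanSpace.complexify ∘ (⇑x : VF)) k) 2).toLp
        (Torus.realTrigPoly S (fun k => mFourierCoeff (EuclideanSpace.complexify ∘ (⇑x : VF)) k))⟫_ℝ
      = ∑ k ∈ S, ‖mFourierCoeff (EuclideanSpace.complexify ∘ (⇑x : VF)) k‖ ^ 2 := by
  rw [MeasureTheory.L2.inner_def, ← Torus.integral_inner_realTrigPoly_self_coeff hS (Lp.memLp x)]
  refine integral_congr_ae ?_
  filter_upwards [(Torus.memLp_realTrigPoly S (fun k => mFourierCoeff (EuclideanSpace.complexify ∘ (⇑x : VF)) k) 2).coeFn_toLp]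
    with ξ hξ
  rw [hξ]

/-- **Energy of the complement of a band piece**: `‖x − piece_S x‖² = ‖x‖² − Σ_{k∈S} ‖x̂ k‖²` (orthogonality). -/
theorem norm_sub_piece_sq (x : V2) {S : Finset (Fin 3 → ℤ)} (hS : ∀ k ∈ S, -k ∈ S) :
    ‖x - (Torus.memLp_realTrigPoly S (fun k => mFourierCoeff (EuclideanSpace.complexify ∘ (⇑x : VF)) k) 2).toLp
        (Torus.realTrigPoly S (fun k => mFourierCoeff (EuclideanSpace.complexify ∘ (⇑x : VF)) k))‖ ^ 2
      = ‖x‖ ^ 2 - ∑ k ∈ S, ‖mFourierCoeff (EuclideanSpace.complexify ∘ (⇑x : VF)) k‖ ^ 2 := by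
  rw [@norm_sub_sq_real, inner_piece x hS, norm_piece_sq x hS]
  ring

/-- The tail energy is nonnegative: `Σ_{k∈S} ‖x̂ k‖² ≤ ‖x‖²` (Bessel). -/
theorem sum_coeff_sq_le_norm_sq (x : V2) {S : Finset (Fin 3 → ℤ)} (hS : ∀ k ∈ S, -k ∈ S) :
    ∑ k ∈ S, ‖mFourierCoeff (EuclideanSpace.complexify ∘ (⇑x : VF)) k‖ ^ 2 ≤ ‖x‖ ^ 2 := by
  have h := norm_sub_piece_sq x hS
  nlinarith [sq_nonneg ‖x - (Torus.memLp_realTrigPoly S (fun k => mFourierCoeff (EuclideanSpace.complexify ∘ (⇑x : VF)) k) 2).toLp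
        (Torus.realTrigPoly S (fun k => mFourierCoeff (EuclideanSpace.complexify ∘ (⇑x : VF)) k))‖]

/-- **Additivity of band pieces over a disjoint union.** -/
theorem piece_union (x : V2) {S₁ S₂ : Finset (Fin 3 → ℤ)} (h : Disjoint S₁ S₂) :
    (Torus.memLp_realTrigPoly (S₁ ∪ S₂) (fun k => mFourierCoeff (EuclideanSpace.complexify ∘ (⇑x : VF)) k) 2).toLp
        (Torus.realTrigPoly (S₁ ∪ S₂) (fun k => mFourierCoeff (EuclideanSpace.complexify ∘ (⇑x : VF)) k))
      = (Torus.memLp_realTrigPoly S₁ (fun k => mFourierCoeff (EuclideanSpace.complexify ∘ (⇑x : VF)) k) 2).toLp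
          (Torus.realTrigPoly S₁ (fun k => mFourierCoeff (EuclideanSpace.complexify ∘ (⇑x : VF)) k))
        + (Torus.memLp_realTrigPoly S₂ (fun k => mFourierCoeff (EuclideanSpace.complexify ∘ (⇑x : VF)) k) 2).toLp
          (Torus.realTrigPoly S₂ (fun k => mFourierCoeff (EuclideanSpace.complexify ∘ (⇑x : VF)) k)) := by
  rw [← MemLp.toLp_add]
  congr 1
  funext ξ
  rw [Pi.add_apply, Torus.realTrigPoly_apply, Torus.realTrigPoly_apply, Torus.realTrigPoly_apply,
    Torus.trigPoly_eq_sum, Torus.trigPoly_eq_sum, Torus.trigPoly_eq_sum, Finset.sum_union h]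
  simp only [Pi.add_apply, Finset.sum_apply, map_add]

/-- **Band pieces of a weakly solenoidal class are weakly solenoidal** (transversal coefficients ⇒ classically divergence free). -/
theorem isWeaklyDivFree_piece (x : V2) (hx : Torus.IsWeaklyDivFree (⇑x : VF)) (S : Finset (Fin 3 → ℤ)) :
    Torus.IsWeaklyDivFree (⇑((Torus.memLp_realTrigPoly S (fun k => mFourierCoeff (EuclideanSpace.complexify ∘ (⇑x : VF)) k) 2).toLp
        (Torus.realTrigPoly S (fun k => mFourierCoeff (EuclideanSpace.complexify ∘ (⇑x : VF)) k))) : VF) := by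
  have hdiv : Torus.IsDivFree (Torus.realTrigPoly S (fun k => mFourierCoeff (EuclideanSpace.complexify ∘ (⇑x : VF)) k)) :=
    Torus.isDivFree_realTrigPoly (hx.isTransversal_mFourierCoeff (Lp.memLp x) S)
  have hw : Torus.IsWeaklyDivFree (Torus.realTrigPoly S (fun k => mFourierCoeff (EuclideanSpace.complexify ∘ (⇑x : VF)) k)) :=
    Torus.IsDivFree.isWeaklyDivFree_holds (Torus.isSmooth_realTrigPoly S _) hdiv
  exact hw.congr_ae (MemLp.coeFn_toLp _).symm

end Pieces

/-! ## §3 The N-currency assembly -/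

/-- **(N1) from a band-loss bound.**  `U` a contraction of `V2`; `Sf` a symmetric frequency set; weights `w ≥ 0`, even; `S₁ = {k ∈ Sf | w k < 1}`
the SLOW modes.  If the band piece of `x` over `S₁` loses at most `Cg·Σ_{k∈S₁} w k‖x̂ k‖²`, then
`lossFwd U x ≤ max 4 (4Cg)·(Σ_{k∈Sf} min 1 (w k)‖x̂ k‖² + (‖x‖² − Σ_{k∈Sf}‖x̂ k‖²))`.
(Split `x` = slow piece + fast piece + tail; `loss_add_add_le`; the fast piece and the tail lose at most their energy.) -/
theorem lossFwd_le_of_bandLoss {U : V2 →L[ℝ] V2} (hU : ∀ y, ‖U y‖ ≤ ‖y‖) {Sf : Finset (Fin 3 → ℤ)} (hSf : ∀ k ∈ Sf, -k ∈ Sf)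
    {w : (Fin 3 → ℤ) → ℝ} (hw0 : ∀ k, 0 ≤ w k) (hw : ∀ k, w (-k) = w k) (Cg : ℝ) (x : V2)
    (hP : lossFwd U ((Torus.memLp_realTrigPoly (Sf.filter fun k => w k < 1)
          (fun k => mFourierCoeff (EuclideanSpace.complexify ∘ (⇑x : VF)) k) 2).toLp
          (Torus.realTrigPoly (Sf.filter fun k => w k < 1) (fun k => mFourierCoeff (EuclideanSpace.complexify ∘ (⇑x : VF)) k)))
        ≤ Cg * ∑ k ∈ Sf.filter (fun k => w k < 1), w k * ‖mFourierCoeff (EuclideanSpace.complexify ∘ (⇑x : VF)) k‖ ^ 2) :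
    lossFwd U x ≤ max 4 (4 * Cg) *
      (∑ k ∈ Sf, min 1 (w k) * ‖mFourierCoeff (EuclideanSpace.complexify ∘ (⇑x : VF)) k‖ ^ 2
        + (‖x‖ ^ 2 - ∑ k ∈ Sf, ‖mFourierCoeff (EuclideanSpace.complexify ∘ (⇑x : VF)) k‖ ^ 2)) := by
  -- notation
  set c : (Fin 3 → ℤ) → EuclideanSpace ℂ (Fin 3) := fun k => mFourierCoeff (EuclideanSpace.complexify ∘ (⇑x : VF)) k with hc
  set S₁ : Finset (Fin 3 → ℤ) := Sf.filter fun k => w k < 1 with hS₁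
  set S₂ : Finset (Fin 3 → ℤ) := Sf.filter fun k => ¬ w k < 1 with hS₂
  have hS₁sym : ∀ k ∈ S₁, -k ∈ S₁ := fun k hk => by
    rw [hS₁, Finset.mem_filter] at hk ⊢; exact ⟨hSf k hk.1, by rw [hw]; exact hk.2⟩
  have hS₂sym : ∀ k ∈ S₂, -k ∈ S₂ := fun k hk => by
    rw [hS₂, Finset.mem_filter] at hk ⊢; exact ⟨hSf k hk.1, by rw [hw]; exact hk.2⟩
  have hdisj : Disjoint S₁ S₂ := Finset.disjoint_filter_filter_not Sf Sf fun k => w k < 1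
  have hunion : S₁ ∪ S₂ = Sf := Finset.filter_union_filter_not_eq _ Sf
  set p₁ : V2 := (Torus.memLp_realTrigPoly S₁ c 2).toLp (Torus.realTrigPoly S₁ c) with hp₁
  set p₂ : V2 := (Torus.memLp_realTrigPoly S₂ c 2).toLp (Torus.realTrigPoly S₂ c) with hp₂
  set pf : V2 := (Torus.memLp_realTrigPoly Sf c 2).toLp (Torus.realTrigPoly Sf c) with hpf
  have hsplit : pf = p₁ + p₂ := by
    rw [hpf, hp₁, hp₂, ← hunion]
    exact piece_union x hdisj
  have hx3 : x = p₁ + p₂ + (x - pf) := by rw [hsplit]; abel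
  -- the three losses
  have hmain := loss_add_add_le hU p₁ p₂ (x - pf)
  rw [← hx3] at hmain
  have h2 : ‖p₂‖ ^ 2 - ‖U p₂‖ ^ 2 ≤ ∑ k ∈ S₂, ‖c k‖ ^ 2 := by
    rw [← norm_piece_sq x hS₂sym]; exact loss_le_norm_sq U p₂
  have h3 : ‖x - pf‖ ^ 2 - ‖U (x - pf)‖ ^ 2 ≤ ‖x‖ ^ 2 - ∑ k ∈ Sf, ‖c k‖ ^ 2 := by
    rw [← norm_sub_piece_sq x hSf]; exact loss_le_norm_sq U (x - pf)
  have h1 : ‖p₁‖ ^ 2 - ‖U p₁‖ ^ 2 ≤ Cg * ∑ k ∈ S₁, w k * ‖c k‖ ^ 2 := hP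
  -- the N-currency splits over `S₁ ⊔ S₂`
  have hN : ∑ k ∈ Sf, min 1 (w k) * ‖c k‖ ^ 2 = ∑ k ∈ S₁, w k * ‖c k‖ ^ 2 + ∑ k ∈ S₂, ‖c k‖ ^ 2 := by
    rw [← hunion, Finset.sum_union hdisj]
    congr 1
    · refine Finset.sum_congr rfl fun k hk => ?_
      rw [hS₁, Finset.mem_filter] at hk
      rw [min_eq_right hk.2.le]
    · refine Finset.sum_congr rfl fun k hk => ?_
      rw [hS₂, Finset.mem_filter] at hk
      rw [min_eq_left (not_lt.1 hk.2), one_mul]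
  have hA1 : 0 ≤ ∑ k ∈ S₁, w k * ‖c k‖ ^ 2 := Finset.sum_nonneg fun k _ => mul_nonneg (hw0 k) (sq_nonneg _)
  have hA2 : 0 ≤ ∑ k ∈ S₂, ‖c k‖ ^ 2 := Finset.sum_nonneg fun k _ => sq_nonneg _
  have hA3 : 0 ≤ ‖x‖ ^ 2 - ∑ k ∈ Sf, ‖c k‖ ^ 2 := sub_nonneg.2 (sum_coeff_sq_le_norm_sq x hSf)
  have hM4 : (4 : ℝ) ≤ max 4 (4 * Cg) := le_max_left _ _
  have hMC : 4 * Cg ≤ max 4 (4 * Cg) := le_max_right _ _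
  unfold lossFwd
  rw [hN]
  calc ‖x‖ ^ 2 - ‖U x‖ ^ 2
      ≤ 4 * (‖p₁‖ ^ 2 - ‖U p₁‖ ^ 2) + 4 * (‖p₂‖ ^ 2 - ‖U p₂‖ ^ 2) + 2 * (‖x - pf‖ ^ 2 - ‖U (x - pf)‖ ^ 2) := hmain
    _ ≤ 4 * (Cg * ∑ k ∈ S₁, w k * ‖c k‖ ^ 2) + 4 * ∑ k ∈ S₂, ‖c k‖ ^ 2 + 2 * (‖x‖ ^ 2 - ∑ k ∈ Sf, ‖c k‖ ^ 2) := by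
        linarith
    _ ≤ max 4 (4 * Cg) * ∑ k ∈ S₁, w k * ‖c k‖ ^ 2 + max 4 (4 * Cg) * ∑ k ∈ S₂, ‖c k‖ ^ 2
          + max 4 (4 * Cg) * (‖x‖ ^ 2 - ∑ k ∈ Sf, ‖c k‖ ^ 2) := by
        nlinarith
    _ = max 4 (4 * Cg) * (∑ k ∈ S₁, w k * ‖c k‖ ^ 2 + ∑ k ∈ S₂, ‖c k‖ ^ 2 + (‖x‖ ^ 2 - ∑ k ∈ Sf, ‖c k‖ ^ 2)) := by ring

/-- **(N1\*) from a band-loss bound** — the adjoint twin: the same statement for `lossAdj U` (apply `lossFwd_le_of_bandLoss` to the contraction `U†`). -/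
theorem lossAdj_le_of_bandLoss {U : V2 →L[ℝ] V2} (hU : ∀ y, ‖U y‖ ≤ ‖y‖) {Sf : Finset (Fin 3 → ℤ)} (hSf : ∀ k ∈ Sf, -k ∈ Sf)
    {w : (Fin 3 → ℤ) → ℝ} (hw0 : ∀ k, 0 ≤ w k) (hw : ∀ k, w (-k) = w k) (Cg : ℝ) (y : V2)
    (hP : lossAdj U ((Torus.memLp_realTrigPoly (Sf.filter fun k => w k < 1)
          (fun k => mFourierCoeff (EuclideanSpace.complexify ∘ (⇑y : VF)) k) 2).toLp
          (Torus.realTrigPoly (Sf.filter fun k => w k < 1) (fun k => mFourierCoeff (EuclideanSpace.complexify ∘ (⇑y : VF)) k)))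
        ≤ Cg * ∑ k ∈ Sf.filter (fun k => w k < 1), w k * ‖mFourierCoeff (EuclideanSpace.complexify ∘ (⇑y : VF)) k‖ ^ 2) :
    lossAdj U y ≤ max 4 (4 * Cg) *
      (∑ k ∈ Sf, min 1 (w k) * ‖mFourierCoeff (EuclideanSpace.complexify ∘ (⇑y : VF)) k‖ ^ 2
        + (‖y‖ ^ 2 - ∑ k ∈ Sf, ‖mFourierCoeff (EuclideanSpace.complexify ∘ (⇑y : VF)) k‖ ^ 2)) :=
  lossFwd_le_of_bandLoss (U := ContinuousLinearMap.adjoint U) (norm_adjoint_le hU) hSf hw0 hw Cg y hP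

/-! ## §4 From a GRADIENT-form band-loss bound (the R4′ shape) to the (N1) shape with rate weights `κ‖k‖²` -/

/-- **(N1′) for one window map from the R4′-shaped input.**  If every band piece of the solenoidal class `x` over a symmetric `S ⊆ Sf` loses at most
`Cg·Σ_{k∈S} ‖k‖²‖x̂ k‖²` under the contraction `U` (Dirichlet-form bound along the drift: `Cg = 2·hi·τ·e^{2·card·G·τ}·4π²` from
`IsPropagator.lossFwd_le_gradNormSq`), then with the rate weights `w k = κ‖k‖²` (`κ = 8π²·lo·kbar m·τ` in the route):
`lossFwd U x ≤ max 4 (4Cg/κ)·(Σ_{k∈Sf} min 1 (κ‖k‖²)‖x̂ k‖² + (‖x‖² − Σ_{k∈Sf}‖x̂ k‖²))`. -/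
theorem lossFwd_le_of_gradLoss {U : V2 →L[ℝ] V2} (hU : ∀ y, ‖U y‖ ≤ ‖y‖) {Sf : Finset (Fin 3 → ℤ)} (hSf : ∀ k ∈ Sf, -k ∈ Sf)
    {κ Cg : ℝ} (hκ : 0 < κ) (x : V2)
    (hgrad : ∀ S : Finset (Fin 3 → ℤ), S ⊆ Sf → (∀ k ∈ S, -k ∈ S) →
      lossFwd U ((Torus.memLp_realTrigPoly S (fun k => mFourierCoeff (EuclideanSpace.complexify ∘ (⇑x : VF)) k) 2).toLp
          (Torus.realTrigPoly S (fun k => mFourierCoeff (EuclideanSpace.complexify ∘ (⇑x : VF)) k)))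
        ≤ Cg * ∑ k ∈ S, ‖Torus.latticeVec k‖ ^ 2 * ‖mFourierCoeff (EuclideanSpace.complexify ∘ (⇑x : VF)) k‖ ^ 2) :
    lossFwd U x ≤ max 4 (4 * (Cg / κ)) *
      (∑ k ∈ Sf, min 1 (κ * ‖Torus.latticeVec k‖ ^ 2) * ‖mFourierCoeff (EuclideanSpace.complexify ∘ (⇑x : VF)) k‖ ^ 2
        + (‖x‖ ^ 2 - ∑ k ∈ Sf, ‖mFourierCoeff (EuclideanSpace.complexify ∘ (⇑x : VF)) k‖ ^ 2)) := by
  have hw0 : ∀ k : Fin 3 → ℤ, 0 ≤ κ * ‖Torus.latticeVec k‖ ^ 2 := fun k => by positivity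
  have hw : ∀ k : Fin 3 → ℤ, κ * ‖Torus.latticeVec (-k)‖ ^ 2 = κ * ‖Torus.latticeVec k‖ ^ 2 := fun k => by
    have e : Torus.latticeVec (-k) = -Torus.latticeVec k := by
      ext i
      rw [Torus.latticeVec_apply, PiLp.neg_apply, Torus.latticeVec_apply, Pi.neg_apply, Int.cast_neg]
    rw [e, norm_neg]
  refine lossFwd_le_of_bandLoss hU hSf hw0 hw (Cg / κ) x ?_
  have hsub : (Sf.filter fun k => κ * ‖Torus.latticeVec k‖ ^ 2 < 1) ⊆ Sf := Finset.filter_subset _ _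
  have hsym : ∀ k ∈ Sf.filter (fun k => κ * ‖Torus.latticeVec k‖ ^ 2 < 1), -k ∈ Sf.filter (fun k => κ * ‖Torus.latticeVec k‖ ^ 2 < 1) :=
    fun k hk => by
      rw [Finset.mem_filter] at hk ⊢
      exact ⟨hSf k hk.1, by rw [hw]; exact hk.2⟩
  refine (hgrad _ hsub hsym).trans (le_of_eq ?_)
  rw [Finset.mul_sum, Finset.mul_sum]
  refine Finset.sum_congr rfl fun k _ => ?_
  field_simp

/-- The adjoint twin of `lossFwd_le_of_gradLoss`. -/
theorem lossAdj_le_of_gradLoss {U : V2 →L[ℝ] V2} (hU : ∀ y, ‖U y‖ ≤ ‖y‖) {Sf : Finset (Fin 3 → ℤ)} (hSf : ∀ k ∈ Sf, -k ∈ Sf)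
    {κ Cg : ℝ} (hκ : 0 < κ) (y : V2)
    (hgrad : ∀ S : Finset (Fin 3 → ℤ), S ⊆ Sf → (∀ k ∈ S, -k ∈ S) →
      lossAdj U ((Torus.memLp_realTrigPoly S (fun k => mFourierCoeff (EuclideanSpace.complexify ∘ (⇑y : VF)) k) 2).toLp
          (Torus.realTrigPoly S (fun k => mFourierCoeff (EuclideanSpace.complexify ∘ (⇑y : VF)) k)))
        ≤ Cg * ∑ k ∈ S, ‖Torus.latticeVec k‖ ^ 2 * ‖mFourierCoeff (EuclideanSpace.complexify ∘ (⇑y : VF)) k‖ ^ 2) :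
    lossAdj U y ≤ max 4 (4 * (Cg / κ)) *
      (∑ k ∈ Sf, min 1 (κ * ‖Torus.latticeVec k‖ ^ 2) * ‖mFourierCoeff (EuclideanSpace.complexify ∘ (⇑y : VF)) k‖ ^ 2
        + (‖y‖ ^ 2 - ∑ k ∈ Sf, ‖mFourierCoeff (EuclideanSpace.complexify ∘ (⇑y : VF)) k‖ ^ 2)) :=
  lossFwd_le_of_gradLoss (U := ContinuousLinearMap.adjoint U) (norm_adjoint_le hU) hSf hκ y hgrad

/-! ## §5 From an ENSTROPHY-form loss bound (the R4′ statement `IsPropagator.loss_le_mul_enstrophy`) to the (N1) shape -/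

/-- `‖latticeVec k‖² = freqNormSq k` (re-derived: `Torus.norm_latticeVec_sq` lives in an unimported file). -/
theorem norm_latticeVec_sq' (k : Fin 3 → ℤ) : ‖Torus.latticeVec k‖ ^ 2 = Torus.freqNormSq k := by
  rw [EuclideanSpace.norm_sq_eq, Torus.freqNormSq]
  refine Finset.sum_congr rfl fun i _ => ?_
  rw [Torus.latticeVec_apply, Real.norm_eq_abs, sq_abs]

/-- The spectral enstrophy depends only on the a.e. class (Fourier coefficients do). -/
theorem eGradNormSq_congr_ae_VF {u u' : VF} (h : u =ᵐ[volume] u') : Torus.eGradNormSq u = Torus.eGradNormSq u' := by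
  unfold Torus.eGradNormSq Torus.eHomSobolevSeminorm
  have hk : ∀ k, mFourierCoeff (EuclideanSpace.complexify ∘ u) k = mFourierCoeff (EuclideanSpace.complexify ∘ u') k := fun k =>
    Torus.mFourierCoeff_congr_ae (h.mono fun ξ hξ => by simp only [Function.comp_apply, hξ]) k
  simp_rw [hk]

/-- **Spectral enstrophy of a band piece**: `Z(piece_S x) = 4π²·Σ_{k∈S} |k|²‖x̂ k‖²` (finite). -/
theorem eGradNormSq_piece (x : V2) {S : Finset (Fin 3 → ℤ)} (hS : ∀ k ∈ S, -k ∈ S) :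
    Torus.eGradNormSq (⇑((Torus.memLp_realTrigPoly S (fun k => mFourierCoeff (EuclideanSpace.complexify ∘ (⇑x : VF)) k) 2).toLp
        (Torus.realTrigPoly S (fun k => mFourierCoeff (EuclideanSpace.complexify ∘ (⇑x : VF)) k))) : VF)
      = ENNReal.ofReal (4 * Real.pi ^ 2 * ∑ k ∈ S, Torus.freqNormSq k * ‖mFourierCoeff (EuclideanSpace.complexify ∘ (⇑x : VF)) k‖ ^ 2) := by
  rw [eGradNormSq_congr_ae_VF (MemLp.coeFn_toLp _), Torus.eGradNormSq_realTrigPoly hS (isConjSymm_coeff x)]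

/-- **(N1′) for one window map from the R4′-shaped (ENSTROPHY) input.**  If `U` is a contraction of `V2` losing at most `Cz·Z(y)` on every weakly
solenoidal `y` of finite spectral enstrophy `Z(y) = eGradNormSq y` (`IsPropagator.loss_le_mul_enstrophy`: `Cz = 2|hi|·τ·e^{2·#d·G·τ}`), then for every
weakly solenoidal `x` and rate weights `κ‖k‖²` (`κ = 8π²·lo·kbar m·τ` in the route):
`lossFwd U x ≤ max 4 (4·(Cz·4π²)/κ)·(Σ_{k∈Sf} min 1 (κ‖k‖²)‖x̂ k‖² + (‖x‖² − Σ_{k∈Sf}‖x̂ k‖²))`. -/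
theorem lossFwd_le_of_enstrophyLoss {U : V2 →L[ℝ] V2} (hU : ∀ y, ‖U y‖ ≤ ‖y‖) {Sf : Finset (Fin 3 → ℤ)} (hSf : ∀ k ∈ Sf, -k ∈ Sf)
    {κ Cz : ℝ} (hκ : 0 < κ) (x : V2) (hx : Torus.IsWeaklyDivFree (⇑x : VF))
    (hR4 : ∀ y : V2, Torus.IsWeaklyDivFree (⇑y : VF) → Torus.eGradNormSq (⇑y : VF) ≠ ⊤ →
      lossFwd U y ≤ Cz * (Torus.eGradNormSq (⇑y : VF)).toReal) :
    lossFwd U x ≤ max 4 (4 * (Cz * (4 * Real.pi ^ 2) / κ)) *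
      (∑ k ∈ Sf, min 1 (κ * ‖Torus.latticeVec k‖ ^ 2) * ‖mFourierCoeff (EuclideanSpace.complexify ∘ (⇑x : VF)) k‖ ^ 2
        + (‖x‖ ^ 2 - ∑ k ∈ Sf, ‖mFourierCoeff (EuclideanSpace.complexify ∘ (⇑x : VF)) k‖ ^ 2)) := by
  refine lossFwd_le_of_gradLoss hU hSf hκ x fun S _ hS => ?_
  have hsum0 : 0 ≤ ∑ k ∈ S, Torus.freqNormSq k * ‖mFourierCoeff (EuclideanSpace.complexify ∘ (⇑x : VF)) k‖ ^ 2 :=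
    Finset.sum_nonneg fun k _ => mul_nonneg (Torus.freqNormSq_nonneg k) (sq_nonneg _)
  have hZ := eGradNormSq_piece x hS
  have h := hR4 _ (isWeaklyDivFree_piece x hx S) (by rw [hZ]; exact ENNReal.ofReal_ne_top)
  rw [hZ, ENNReal.toReal_ofReal (by positivity)] at h
  refine h.trans (le_of_eq ?_)
  have hsum : ∑ k ∈ S, ‖Torus.latticeVec k‖ ^ 2 * ‖mFourierCoeff (EuclideanSpace.complexify ∘ (⇑x : VF)) k‖ ^ 2
      = ∑ k ∈ S, Torus.freqNormSq k * ‖mFourierCoeff (EuclideanSpace.complexify ∘ (⇑x : VF)) k‖ ^ 2 :=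
    Finset.sum_congr rfl fun k _ => by rw [norm_latticeVec_sq']
  rw [hsum]
  ring

/-- The adjoint twin of `lossFwd_le_of_enstrophyLoss` (the adjoint of a propagator window map is the propagator of the reversed problem,
`Torus.adjoint_propagator`, so R4′ applies to it with the same constants). -/
theorem lossAdj_le_of_enstrophyLoss {U : V2 →L[ℝ] V2} (hU : ∀ y, ‖U y‖ ≤ ‖y‖) {Sf : Finset (Fin 3 → ℤ)} (hSf : ∀ k ∈ Sf, -k ∈ Sf)
    {κ Cz : ℝ} (hκ : 0 < κ) (y : V2) (hy : Torus.IsWeaklyDivFree (⇑y : VF))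
    (hR4 : ∀ z : V2, Torus.IsWeaklyDivFree (⇑z : VF) → Torus.eGradNormSq (⇑z : VF) ≠ ⊤ →
      lossAdj U z ≤ Cz * (Torus.eGradNormSq (⇑z : VF)).toReal) :
    lossAdj U y ≤ max 4 (4 * (Cz * (4 * Real.pi ^ 2) / κ)) *
      (∑ k ∈ Sf, min 1 (κ * ‖Torus.latticeVec k‖ ^ 2) * ‖mFourierCoeff (EuclideanSpace.complexify ∘ (⇑y : VF)) k‖ ^ 2
        + (‖y‖ ^ 2 - ∑ k ∈ Sf, ‖mFourierCoeff (EuclideanSpace.complexify ∘ (⇑y : VF)) k‖ ^ 2)) :=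
  lossFwd_le_of_enstrophyLoss (U := ContinuousLinearMap.adjoint U) (norm_adjoint_le hU) hSf hκ y hy hR4

end Summit.AnomalousDissipation.AnomalousDissipation.Theorems.SolenoidalFractalHomogenisation.LagrangianStep.N1Assembly

end
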